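import Literature.Probability.Percolation.ChayesLeiHexProofs
import Literature.Probability.Percolation.TriApproxDomain
import HarnessLib

/-!
# Route CardyBondTriangular · crux `BondTriangularCardy` (stmt-CriticalPhenomena-4664), line `birth`:
# the three-arm difference forces an open arm (combinatorics and the Chayes–Lei dictionary)

Helper of stub `stub_threeArmSmall` (Bollobás–Riordan's (12) on compacta for critical bond-`𝕋`),
the model-free part of Claim 10 (Bollobás–Riordan, *Percolation* (2006), Ch. 7, p. 177) for the
Chayes–Lei hexagon representation of bond percolation on `𝕋` (`ChayesLeiHex`): if the separating
event `Eⁱ(z)` of a 3-marked discrete domain `G` holds at the face `z` opposite the `j`-th vertex of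
the triangle `w` of `G` but `Eⁱ(w)` fails, then the separating yellow path `P` of `Eⁱ(z)` must
block the single dual step `z → w` across their common edge `{x, y} ⊆ G`, i.e. the bond `s(x, y)`
is a bond of `P`; so `P` passes through a vertex `x` of `w`, and its initial piece is a yellow
path of hexagons of `G` from a hexagon of the arc `A_{i+1}` to `x`
(`clSepEvent_diff_subset_yellowArm`). Under the packaging `clOfBond` of a bond configuration `ω`,
yellow connectivity of hexagons is open-bond connectivity of the sites of the packaged
up-triangles (`openGraph_reachable_of_clYellowGraph_walk`), whence an open path of `𝕋` from a site
within distance `2` of the centre of `w` to a site within distance `1` of a site of `A_{i+1}`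
(`bondTri_sepDiff_openArm`, the registered helper signature). No probability here.

References: B. Bollobás, O. Riordan, *Percolation*, CUP 2006, Ch. 7, Claim 10 p. 177 and (12)
p. 181 [BollobasRiordan2006]; L. Chayes, H. K. Lei, Rev. Math. Phys. 19 (2007) §2.1
[ChayesLei2007].
-/

noncomputable section

namespace Summit.CriticalPhenomena.CardyFormulaZ2.Theorems

open Literature.Probability.Percolation Literature.Probability.LatticeModels

/-- **`Eⁱ(z) ∖ Eⁱ(w)` forces a yellow arm from `A_{i+1}` to a vertex of `w`** (the model-free part
of Bollobás–Riordan's Claim 10 for the Chayes–Lei separating events): if the hexagons of the three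
vertices of the face `w` lie in `G`, `z = oppFace w j`, and a configuration `σ` lies in
`Eⁱ(z) ∖ Eⁱ(w)`, then some vertex `x` of `w` is joined to a hexagon `du.1` of the `(i+1)`-st
stretch by a path of hexagons of `G`, none pure blue, consecutive ones sharing a yellow
(half-)edge. Indeed the separating path `P` of `Eⁱ(z)` does not separate `w`, so the dual step
`z → w` (across a bond of `G`, as `hexFaceVertices w ⊆ G`) is blocked by a bond of `P`, one of
whose endpoints is a vertex of `w` on `P`; the initial segment of `P` up to it is the arm.
[cite: BollobasRiordan2006, Ch. 7 Claim 10 p. 177] -/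
theorem clSepEvent_diff_subset_yellowArm (D : TriMarkedDomain 3) {w : HexVertex}
    (hw : hexFaceVertices w ⊆ D.verts) (i j : Fin 3) :
    D.clSepEvent i (oppFace w j) \ D.clSepEvent i w ⊆
      {σ | ∃ x ∈ hexFaceVertices w, ∃ du ∈ D.stretch (i + 1), ∃ P : triGraph.Walk du.1 x,
        (∀ y ∈ P.support, y ∈ D.verts ∧ σ y ≠ CLHexState.B) ∧
          ∀ d ∈ P.darts, (clYellowGraph σ).Adj d.fst d.snd} := by
  rintro σ ⟨⟨du, dv, P, hP, hu, hv, hyu, hyv, hsupp, hdarts, hsep⟩, hnot⟩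
  have hnsep : ¬ Separates D.verts {e | e ∈ P.edges} w (D.stretch i) := fun h =>
    hnot ⟨du, dv, P, hP, hu, hv, hyu, hyv, hsupp, hdarts, h⟩
  -- the single dual step `z → w` must be blocked by a bond of `P`
  have hstep : ¬ DualStep D.verts {e | e ∈ P.edges} (oppFace w j) w := by
    intro hzw
    refine hnsep fun F hF hchain => ?_
    exact hsep F hF (Relation.ReflTransGen.head hzw hchain)
  have hadj : hexGraph.Adj (oppFace w j) w := (hexGraph_adj_oppFace w j).symm
  have hedge : faceEdge (oppFace w j) w ⊆ D.verts := fun y hy => hw (Finset.mem_inter.1 hy).2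
  have hex : ∃ x y : Site 2, faceEdge (oppFace w j) w = {x, y} ∧ s(x, y) ∈ P.edges := by
    by_contra hne
    push Not at hne
    exact hstep ⟨hadj, hedge, fun x y hxy => hne x y hxy⟩
  obtain ⟨x, y, hxy, hmem⟩ := hex
  have hxw : x ∈ hexFaceVertices w := by
    have : x ∈ faceEdge (oppFace w j) w := by rw [hxy]; exact Finset.mem_insert_self x {y}
    exact (Finset.mem_inter.1 this).2
  have hxP : x ∈ P.support := P.fst_mem_support_of_mem_edges hmem
  refine ⟨x, hxw, du, hu, P.takeUntil x hxP, fun y hy => hsupp y ?_, fun d hd => hdarts d ?_⟩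
  · exact P.support_takeUntil_subset_support hxP hy
  · exact P.darts_takeUntil_subset_darts hxP hd

/-- A walk of `G` all of whose darts are edges of `H` joins its endpoints in `H`. [folklore] -/
theorem reachable_of_forall_darts_adj {V : Type*} {G H : SimpleGraph V} {a b : V} (P : G.Walk a b)
    (hP : ∀ d ∈ P.darts, H.Adj d.fst d.snd) : H.Reachable a b := by
  induction P with
  | nil => rfl
  | @cons u v w huv P ih =>
    have h1 : H.Adj u v := hP ⟨(u, v), huv⟩ (by simp)
    exact h1.reachable.trans (ih fun d hd => hP d (by simp [hd]))

/-- A packaged up-triangle which is not pure blue has an active site (an endpoint of an open bond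
of the triangle) among its three vertices. [cite: ChayesLei2007, §2.1 p. 4] -/
theorem exists_isActiveSite_of_ne_B {ω : BondConfig (Site 2)} {x : Site 2}
    (hx : clOfBond ω x ≠ CLHexState.B) : ∃ k : Fin 3, IsActiveSite ω x (faceVertex (x, 0) k) := by
  rw [Ne, clOfBond_eq_B_iff] at hx
  push Not at hx
  obtain ⟨j, hj⟩ := hx
  exact ⟨j + 1, j, hj, Sym2.mem_mk_left _ _⟩

/-- The vertices of the up-triangle of `x` are within distance `1` of `x` in the equilateral
drawing (they are `x`, `x + e₀`, `x + e₁`). [folklore] -/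
theorem norm_triEmbed_faceVertex_sub_le (x : Site 2) (k : Fin 3) :
    ‖triEmbed (faceVertex (x, 0) k) - triEmbed x‖ ≤ 1 := by
  by_cases h : faceVertex (x, 0) k = x
  · rw [h, sub_self, norm_zero]; exact zero_le_one
  · have hx0 : x ∈ hexFaceVertices ((x, 0) : HexVertex) := by
      have := faceVertex_mem ((x, 0) : HexVertex) 0
      rwa [faceVertex_up, triUnit_zero, add_zero] at this
    exact (norm_triEmbed_eq_one_of_adj (adj_of_mem_hexFaceVertices (faceVertex_mem (x, 0) k) hx0 h)).le

/-- **`Eⁱ(z) ∖ Eⁱ(w)` forces an open arm of the bond lattice** (registered helper of stub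
`stub_threeArmSmall`): for bond percolation on `𝕋` read through the Chayes–Lei packaging `clOfBond`,
if `Eⁱ(oppFace w j) ∖ Eⁱ(w)` holds in a 3-marked discrete domain `G` with `hexFaceVertices w ⊆ G`,
then there is an open path of `𝕋` from a site `a` within Euclidean distance `2` of the centre of
`w` to a site `b` within distance `1` of a site of the arc `A_{i+1}` — the yellow arm of
`clSepEvent_diff_subset_yellowArm` read in the bond language ("yellow connectivity in the hexagon
language corresponds to bond connectivity in the direct model", Chayes–Lei 2007 §2.1;
`openGraph_reachable_of_clYellowGraph_walk`), its ends being active sites of the packaged triangles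
of a vertex of `w` and of a hexagon of `A_{i+1}`. [cite: BollobasRiordan2006, Ch. 7 Claim 10 p. 177] -/
theorem bondTri_sepDiff_openArm : ∀ (D : Literature.Probability.Percolation.TriMarkedDomain 3) (w : Literature.Probability.LatticeModels.HexVertex), Literature.Probability.LatticeModels.hexFaceVertices w ⊆ D.verts → ∀ (i j : Fin 3) (ω : Literature.Probability.Percolation.BondConfig (Literature.Probability.LatticeModels.Site 2)), Literature.Probability.Percolation.clOfBond ω ∈ D.clSepEvent i (Literature.Probability.Percolation.oppFace w j) \ D.clSepEvent i w → ∃ a b : Literature.Probability.LatticeModels.Site 2, (Literature.Probability.Percolation.openGraph ω).Reachable a b ∧ ‖Literature.Probability.LatticeModels.triEmbed a - Literature.Probability.LatticeModels.hexCenter w‖ ≤ 2 ∧ ∃ t ∈ D.arc (i + 1), ‖Literature.Probability.LatticeModels.triEmbed b - Literature.Probability.LatticeModels.triEmbed t‖ ≤ 1 := by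
  intro D w hw i j ω hω
  obtain ⟨x, hxw, du, hu, P, hsupp, hdarts⟩ := clSepEvent_diff_subset_yellowArm D hw i j hω
  obtain ⟨k, hk⟩ := exists_isActiveSite_of_ne_B (hsupp x P.end_mem_support).2
  obtain ⟨k', hk'⟩ := exists_isActiveSite_of_ne_B (hsupp du.1 P.start_mem_support).2
  obtain ⟨W⟩ := reachable_of_forall_darts_adj P hdarts
  have hreach : (openGraph ω).Reachable (faceVertex (du.1, 0) k') (faceVertex (x, 0) k) :=
    openGraph_reachable_of_clYellowGraph_walk W hk' hk
  -- a vertex of a face is within distance `1` of its centre (in fact at distance `1/√3`)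
  have hxc : ‖triEmbed x - hexCenter w‖ ≤ 1 := by
    have h := dist_triMeshPoint_hexCenter_le hxw 1
    simp only [triMeshPoint, Complex.ofReal_one, one_mul, abs_one, dist_eq_norm] at h
    exact h
  refine ⟨faceVertex (x, 0) k, faceVertex (du.1, 0) k', hreach.symm, ?_, du.1,
    Finset.mem_image_of_mem _ hu, norm_triEmbed_faceVertex_sub_le du.1 k'⟩
  calc ‖triEmbed (faceVertex (x, 0) k) - hexCenter w‖
      ≤ ‖triEmbed (faceVertex (x, 0) k) - triEmbed x‖ + ‖triEmbed x - hexCenter w‖ :=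
        norm_sub_le_norm_sub_add_norm_sub _ _ _
    _ ≤ 1 + 1 := add_le_add (norm_triEmbed_faceVertex_sub_le x k) hxc
    _ = 2 := by norm_num

end Summit.CriticalPhenomena.CardyFormulaZ2.Theorems

end
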